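import Summits.CriticalPhenomena.Ising3DConformalLimit.Theses.SubPtolemyInterlacing
import Literature.Probability.LatticeModels.CriticalUrsellFourSign
import Literature.Probability.LatticeModels.CriticalAxisRatioRegularity
import HarnessLib

/-!
# Line `Sketch` for the crux `SubPtolemyInterlacing.Interlacing` (stmt-CriticalPhenomena-15702) — stub `stub_logConvex`

Axial log-convexity of the critical two-point function on `ℤ³` (`t ≥ 1`, i.e. `P₂ ≤ P₃`):
`G(a+b) G(b+c) ≤ G(a+b+c) G(b)`, from `criticalTwoPoint_axis_sq_le` (reflection positivity, ADC21 Prop. 5.3/5.9).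

Helper file of the line `Sketch` (lead skeleton `Cruxes/Interlacing/Lines/Sketch.lean`): proves the registered stub
`stub_logConvex` verbatim (name + signature). No definitions, no named facts, no sorry.
-/

noncomputable section

namespace Summit.CriticalPhenomena.Ising3DConformalLimit.Cruxes.Interlacing.Sketch

open Filter MeasureTheory
open scoped symmDiff Topology
open Literature.Probability.LatticeModels Literature.Probability.Percolation

/-- Ratio monotonicity of a positive log-convex sequence on `ℕ` (pure algebra):
if `G (k+1)² ≤ G k · G (k+2)` for all `k`, then `G (m+1) / G m ≤ G (n+1) / G n` for `m ≤ n`,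
in cross-multiplied form. -/
private theorem ratio_mono_of_logConvex {G : ℕ → ℝ} (hpos : ∀ n, 0 < G n)
    (hsq : ∀ k, G (k + 1) * G (k + 1) ≤ G k * G (k + 1 + 1)) {m n : ℕ} (hmn : m ≤ n) :
    G (m + 1) * G n ≤ G (n + 1) * G m := by
  induction n, hmn using Nat.le_induction with
  | base => exact le_rfl
  | succ n hmn ih =>
    -- multiply `ih : G (m+1) G n ≤ G (n+1) G m` with `hsq n : G (n+1)² ≤ G n G (n+2)` and cancel
    -- the positive factor `G n * G (n+1)`.
    have hc : 0 < G n * G (n + 1) := mul_pos (hpos n) (hpos (n + 1))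
    refine le_of_mul_le_mul_right ?_ hc
    calc G (m + 1) * G (n + 1) * (G n * G (n + 1))
        = G (m + 1) * G n * (G (n + 1) * G (n + 1)) := by ring
      _ ≤ G (n + 1) * G m * (G n * G (n + 1 + 1)) :=
          mul_le_mul ih (hsq n) (mul_nonneg (hpos _).le (hpos _).le)
            (mul_nonneg (hpos _).le (hpos _).le)
      _ = G (n + 1 + 1) * G m * (G n * G (n + 1)) := by ring

/-- Interlacing consequence of log-convexity for a positive sequence on `ℕ` (pure algebra):
`G (a+b) · G (b+c) ≤ G (a+b+c) · G b`, i.e. `k ↦ G (k+c) / G k` is nondecreasing. -/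
private theorem interlace_of_logConvex {G : ℕ → ℝ} (hpos : ∀ n, 0 < G n)
    (hsq : ∀ k, G (k + 1) * G (k + 1) ≤ G k * G (k + 1 + 1)) (a b c : ℕ) :
    G (a + b) * G (b + c) ≤ G (a + b + c) * G b := by
  induction a with
  | zero =>
    rw [Nat.zero_add, mul_comm]
  | succ a ih =>
    -- multiply `ih` with the ratio inequality between indices `a+b ≤ a+b+c` and cancel the positive
    -- factor `G (a+b) * G (a+b+c)`.
    have hr : G (a + b + 1) * G (a + b + c) ≤ G (a + b + c + 1) * G (a + b) :=
      ratio_mono_of_logConvex hpos hsq (Nat.le_add_right (a + b) c)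
    have hc : 0 < G (a + b) * G (a + b + c) := mul_pos (hpos _) (hpos _)
    rw [show a + 1 + b = a + b + 1 by omega, show a + b + 1 + c = a + b + c + 1 by omega]
    refine le_of_mul_le_mul_right ?_ hc
    calc G (a + b + 1) * G (b + c) * (G (a + b) * G (a + b + c))
        = G (a + b) * G (b + c) * (G (a + b + 1) * G (a + b + c)) := by ring
      _ ≤ G (a + b + c) * G b * (G (a + b + c + 1) * G (a + b)) :=
          mul_le_mul ih hr (mul_nonneg (hpos _).le (hpos _).le)
            (mul_nonneg (hpos _).le (hpos _).le)
      _ = G (a + b + c + 1) * G b * (G (a + b) * G (a + b + c)) := by ring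

/-- `⟨σ₀σ_{n e₁}⟩_{β_c} > 0` on `ℤ³`: the Simon–Lieb lower bound `c‖x‖⁻² ≤ ⟨σ₀σ_x⟩_{β_c}` off the
origin (`criticalTwoPoint_bounds_holds`) and `⟨σ₀σ₀⟩ = 1` at it. -/
private theorem criticalTwoPoint_axis0_pos (n : ℕ) :
    0 < criticalTwoPoint 3 (Pi.single 0 (n : ℤ)) := by
  by_cases hx : (Pi.single 0 (n : ℤ) : Site 3) = 0
  · rw [hx, criticalTwoPoint_zero']; exact one_pos
  · obtain ⟨c, C, hc, hb⟩ := criticalTwoPoint_bounds_holds (d := 3) le_rfl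
    exact lt_of_lt_of_le (mul_pos hc (Real.rpow_pos_of_pos (norm_pos_iff.2 hx) _)) (hb _ hx).1

/-- One-step axial log-convexity from index `0`: `G (k+1)² ≤ G k · G (k+2)` for all `k : ℕ`
(`criticalTwoPoint_axis_sq_le` at `n = k + 1 ≥ 1`). -/
private theorem criticalTwoPoint_axis0_sq_le (k : ℕ) :
    criticalTwoPoint 3 (Pi.single 0 ((k + 1 : ℕ) : ℤ)) *
        criticalTwoPoint 3 (Pi.single 0 ((k + 1 : ℕ) : ℤ)) ≤
      criticalTwoPoint 3 (Pi.single 0 (k : ℤ)) *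
        criticalTwoPoint 3 (Pi.single 0 ((k + 1 + 1 : ℕ) : ℤ)) := by
  have key := criticalTwoPoint_axis_sq_le 0 (n := k + 1) (by omega)
  rw [show k + 1 - 1 = k by omega, sq] at key
  exact key

/-- **Stub `stub_logConvex`** of the line `Sketch` (crux stmt-CriticalPhenomena-15702): Axial log-convexity of the critical two-point function on `ℤ³` (`t ≥ 1`, i.e. `P₂ ≤ P₃`): `G(a+b) G(b+c) ≤ G(a+b+c) G(b)`, from `criticalTwoPoint_axis_sq_le` (reflection positivity, ADC21 Prop. 5.3/5.9). -/
theorem stub_logConvex : ∀ a b c : ℕ,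
    criticalTwoPoint 3 (Pi.single 0 ((a + b : ℕ) : ℤ)) * criticalTwoPoint 3 (Pi.single 0 ((b + c : ℕ) : ℤ)) ≤
      criticalTwoPoint 3 (Pi.single 0 ((a + b + c : ℕ) : ℤ)) * criticalTwoPoint 3 (Pi.single 0 ((b : ℕ) : ℤ)) := by
  intro a b c
  exact interlace_of_logConvex (G := fun n : ℕ => criticalTwoPoint 3 (Pi.single 0 (n : ℤ)))
    criticalTwoPoint_axis0_pos criticalTwoPoint_axis0_sq_le a b c

end Summit.CriticalPhenomena.Ising3DConformalLimit.Cruxes.Interlacing.Sketch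

end
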